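import Mathlib

/-!
# The branch-point table from induction along the three pairings (finite group theory of `S₄`)

Helper file for item stmt-Langlands-13760 (`ResidualAutomorphyEven`, route `PicardMuOrdinary`), module
"M2" of the prover's architecture (NOTES.md): the purely finite-group identity behind
"`Ind_{D₈}^{S₄} ε = reflection`" read on characteristic polynomials, in the shape in which the
automorphic induction of the quadratic character `ε` of the cubic resolvent extension delivers its
Hecke polynomials.

Let `g ∈ S₄ = Perm (Fin 4)` (a Frobenius element acting on the four roots of the quartic `f`).  The
three **pairings** `{{0,j},{k,l}}` of `Fin 4` (indexed by the partner `j` of `0`, type `Pairing = Fin 3`)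
are permuted by `g`; the places `w ∣ v` of the cubic resolvent extension `E/K` correspond to the
`⟨g⟩`-orbits `O` on the pairings, with residue degree `f(w|v) = #O`, and the quadratic character `ε`
(kernel: the permutations preserving the two blocks of the pairing) takes at `Frob_w` the value
`blockSign (g ^ #O) p` (`p ∈ O`).  The **induced local factor** of `ε` at `g` is therefore
`∏_O (X^{#O} - ε_O)`; this file proves (by exhausting `S₄`, `decide` on finite data) that it equals the
branch-point table polynomial of the route, indexed by the number of fixed points of `g` (= number of
roots of `f mod 𝔭`) and the sign of `g` (= square class of the discriminant):
`(X-1)³`, `(X-1)²(X+1)`, `X³-1`, `(X-1)(X+1)²`, `X³+X²+X+1` (`inducedPoly_eq_tablePoly`).  It also records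
that the table polynomial times `X - 1` is `∏_{cycles c of g} (X^{#c} - 1)`, the characteristic polynomial
of the permutation matrix of `g` (`tablePoly_mul_X_sub_one`), i.e. the table is the characteristic
polynomial of `g` on `ℤ[Fin 4]/diagonal`.

No analysis, no named fact; everything is decided on `Fin 4`.
-/

set_option linter.dupNamespace false -- project-wide option (lakefile weak.linter.dupNamespace); `Summit.Langlands.Langlands` is the mandated namespace

namespace Summit.Langlands.Langlands.Theorems.ResidualAutomorphyEven

open Polynomial Equiv

/-- A **pairing** of `Fin 4` into two blocks of size two, indexed by the partner of `0`:
`p : Fin 3` stands for `{{0, p+1}, complement}`. -/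
abbrev Pairing := Fin 3

namespace Pairing

/-- The block of `i` in the pairing `p`: `true` for the block `{0, p+1}` of `0`, `false` for the other. -/
def blk (p : Pairing) (i : Fin 4) : Bool := decide (i = 0 ∨ i = p.succ)

/-- `i` and `j` lie in the same block of `p`. -/
def sameBlock (p : Pairing) (i j : Fin 4) : Bool := p.blk i == p.blk j

/-- The image of the pairing `p` under the permutation `g` of `Fin 4`: the pairing `q` with
`{g i, g j}` a block of `q` iff `{i, j}` is a block of `p` (found by search over the three pairings;
`actPairing_spec` certifies the search). -/
def act (g : Perm (Fin 4)) (p : Pairing) : Pairing :=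
  ((List.finRange 3).find? fun q => decide (∀ i j : Fin 4, sameBlock q (g i) (g j) = sameBlock p i j)).getD 0

/-- The search in `Pairing.act` succeeds: `g • p` has blocks the images of the blocks of `p`. -/
theorem act_spec : ∀ (g : Perm (Fin 4)) (p : Pairing) (i j : Fin 4),
    sameBlock (act g p) (g i) (g j) = sameBlock p i j := by decide

/-- A pairing is determined by its same-block relation. -/
theorem eq_of_sameBlock_eq : ∀ q q' : Pairing, (∀ i j : Fin 4, sameBlock q i j = sameBlock q' i j) → q = q' := by
  decide

/-- `Pairing.act` is an action: identity. -/
theorem act_one : ∀ p : Pairing, act 1 p = p := by decide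

/-- `Pairing.act` is an action: compatibility with composition (from the characterisation
`act_spec` and `eq_of_sameBlock_eq`). -/
theorem act_mul (g h : Perm (Fin 4)) (p : Pairing) : act (g * h) p = act g (act h p) := by
  refine eq_of_sameBlock_eq _ _ fun i j => ?_
  have h1 := act_spec (g * h) p (h⁻¹ (g⁻¹ i)) (h⁻¹ (g⁻¹ j))
  have h2 := act_spec g (act h p) (g⁻¹ i) (g⁻¹ j)
  have h3 := act_spec h p (h⁻¹ (g⁻¹ i)) (h⁻¹ (g⁻¹ j))
  simp only [Perm.mul_apply, Perm.coe_inv, Equiv.apply_symm_apply] at h1 h2 h3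
  rw [h1, h2, h3]

/-- The **block sign** of `h` at the pairing `p` (meaningful when `h` fixes `p`): `+1` if `h` maps the
block of `0` to itself, `-1` if it exchanges the two blocks.  On the stabiliser `D₈` of `p` in `S₄` this
is the quadratic character `ε` with `Ind_{D₈}^{S₄} ε =` the reflection representation; on the stabiliser
`V₄` in `A₄` it is a non-trivial character of the Klein group. -/
def blockSign (h : Perm (Fin 4)) (p : Pairing) : ℤ := if p.blk (h 0) then 1 else -1

/-- On the stabiliser of a pairing the block sign is multiplicative (it is a character `ε`). -/
theorem blockSign_mul_of_act_eq : ∀ (a b : Perm (Fin 4)) {p : Pairing}, act a p = p → act b p = p →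
    blockSign a p = 1 → blockSign b p = 1 → blockSign (a * b) p = 1 := by decide

/-- The block sign is a character on the stabiliser: general product formula. -/
theorem blockSign_mul : ∀ (a b : Perm (Fin 4)) (p : Pairing), act a p = p → act b p = p →
    blockSign (a * b) p = blockSign a p * blockSign b p := by decide

/-- The kernel of the block sign on the stabiliser is closed under inverses. -/
theorem blockSign_inv_of_act_eq : ∀ (a : Perm (Fin 4)) {p : Pairing}, act a p = p →
    blockSign a p = 1 → blockSign a⁻¹ p = 1 := by decide

/-- The block sign of an inverse. -/
theorem blockSign_inv : ∀ (a : Perm (Fin 4)) (p : Pairing), act a p = p →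
    blockSign a⁻¹ p = blockSign a p := by decide

/-- The block sign takes the values `±1`. -/
theorem blockSign_eq_one_or : ∀ (a : Perm (Fin 4)) (p : Pairing), blockSign a p = 1 ∨ blockSign a p = -1 := by
  decide

/-- The size of the `⟨g⟩`-orbit of the pairing `p` (`1`, `2` or `3`). -/
def period (g : Perm (Fin 4)) (p : Pairing) : ℕ :=
  if act g p = p then 1 else if act g (act g p) = p then 2 else 3

/-- `g ^ period` fixes the pairing (so `blockSign (g ^ period g p) p` is the value of `ε` at the
Frobenius of the corresponding place). -/
theorem act_pow_period : ∀ (g : Perm (Fin 4)) (p : Pairing), act (g ^ period g p) p = p := by decide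

/-- `p` is the least element of its `⟨g⟩`-orbit (a canonical orbit representative). -/
def isRep (g : Perm (Fin 4)) (p : Pairing) : Bool := decide (p ≤ act g p) && decide (p ≤ act g (act g p))

end Pairing

open Pairing

/-- The **induced local data** of the block-sign character at `g`: one pair
`(#O, ε(g^{#O}))` per `⟨g⟩`-orbit `O` on the pairings (orbit listed by its least element). -/
def inducedData (g : Perm (Fin 4)) : Multiset (ℕ × ℤ) :=
  ((Finset.univ.filter fun p : Pairing => isRep g p).val).map
    fun p => (period g p, blockSign (g ^ period g p) p)

/-- The number of fixed points of `g` on `Fin 4` (for a Frobenius element: the number of roots of the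
quartic in the residue field). -/
def fixedCard (g : Perm (Fin 4)) : ℕ := (Finset.univ.filter fun i : Fin 4 => g i = i).card

/-- The **expected data** by number of fixed points `n` and sign `s`: identity `(1⁴)`, transposition
`(2,1²)`, three-cycle `(3,1)`, double transposition `(2²)` (even), four-cycle `(4)` (odd). -/
def tableData (n : ℕ) (s : ℤˣ) : Multiset (ℕ × ℤ) :=
  if n = 4 then {(1, 1), (1, 1), (1, 1)}
  else if n = 2 then {(1, 1), (2, 1)}
  else if n = 1 then {(3, 1)}
  else if s = 1 then {(1, 1), (1, -1), (1, -1)}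
  else {(1, -1), (2, -1)}

/-- **The induction identity on finite data**: for every `g ∈ S₄` the orbit/sign data of the block-sign
character equal the table data read off from the number of fixed points and the sign of `g`
(exhaustion of the 24 permutations). -/
theorem inducedData_eq_tableData : ∀ g : Perm (Fin 4),
    inducedData g = tableData (fixedCard g) (Perm.sign g) := by decide

/-- The polynomial `∏_{(m, s)} (X^m - s)` attached to orbit/sign data. -/
noncomputable def dataPoly (D : Multiset (ℕ × ℤ)) : ℤ[X] :=
  (D.map fun ms => X ^ ms.1 - C ms.2).prod

/-- The **induced local factor** `∏_O (X^{#O} - ε(g^{#O}))` of the block-sign character at `g`. -/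
noncomputable def inducedPoly (g : Perm (Fin 4)) : ℤ[X] := dataPoly (inducedData g)

/-- The **branch-point table** of route `PicardMuOrdinary` as a function of the number `n` of roots of
`f mod 𝔭` and of whether the discriminant is a square (`sq`): verbatim the five-way `if` of the route
decls `ResidualAutomorphyEven` / `ResidualAutomorphyOdd` / `MuOrdinaryFamilyRT`. -/
noncomputable def tablePoly (n : ℕ) (sq : Prop) [Decidable sq] : ℤ[X] :=
  if n = 4 then (X - 1) ^ 3
  else if n = 2 then (X - 1) ^ 2 * (X + 1)
  else if n = 1 then X ^ 3 - 1
  else if sq then (X - 1) * (X + 1) ^ 2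
  else X ^ 3 + X ^ 2 + X + 1

/-- The table data give the table polynomials (five small ring identities). -/
theorem dataPoly_tableData (n : ℕ) (s : ℤˣ) :
    dataPoly (tableData n s) = tablePoly n (s = 1) := by
  unfold tableData tablePoly
  split_ifs <;>
    simp only [dataPoly, Multiset.insert_eq_cons, Multiset.map_cons, Multiset.map_singleton,
      Multiset.prod_cons, Multiset.prod_singleton, pow_one, map_one, map_neg] <;> ring

/-- **Main identity (M2).** For every `g ∈ S₄`, the induced local factor of the block-sign character
equals the branch-point table polynomial indexed by the number of fixed points of `g` and by
`sign g = 1`. -/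
theorem inducedPoly_eq_tablePoly (g : Perm (Fin 4)) :
    inducedPoly g = tablePoly (fixedCard g) (Perm.sign g = 1) := by
  rw [inducedPoly, inducedData_eq_tableData, dataPoly_tableData]

/-- The cycle data of `g` as a permutation of `Fin 4`, including fixed points: the multiset of orbit
sizes of `⟨g⟩` on `Fin 4` (so that `∏ (X^{m} - 1)` over it is the characteristic polynomial of the
permutation matrix of `g`). -/
def orbitSizes (g : Perm (Fin 4)) : Multiset ℕ :=
  g.cycleType + Multiset.replicate (fixedCard g) 1

/-- Orbit sizes by number of fixed points and sign (exhaustion of `S₄`). -/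
theorem orbitSizes_eq : ∀ g : Perm (Fin 4), orbitSizes g =
    (if fixedCard g = 4 then {1, 1, 1, 1} else if fixedCard g = 2 then {2, 1, 1}
      else if fixedCard g = 1 then {3, 1} else if Perm.sign g = 1 then {2, 2} else {4}) := by
  decide

/-- **The table is the characteristic polynomial of `g` on `ℤ[Fin 4]/diagonal`**: multiplied by the
factor `X - 1` of the diagonal it is `∏_{orbits} (X^{size} - 1)`, the characteristic polynomial of the
permutation matrix of `g`. -/
theorem tablePoly_mul_X_sub_one (g : Perm (Fin 4)) :
    tablePoly (fixedCard g) (Perm.sign g = 1) * (X - 1) =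
      ((orbitSizes g).map fun m => (X : ℤ[X]) ^ m - 1).prod := by
  rw [orbitSizes_eq]
  unfold tablePoly
  split_ifs <;>
    simp only [Multiset.insert_eq_cons, Multiset.map_cons, Multiset.map_singleton,
      Multiset.prod_cons, Multiset.prod_singleton, pow_one] <;> ring


namespace Pairing

/-- The action of `S₄` on the three pairings as a homomorphism `Perm (Fin 4) →* Perm (Fin 3)`
(the classical surjection `S₄ → S₃`). -/
def actHom : Perm (Fin 4) →* Perm Pairing where
  toFun g :=
    { toFun := act g
      invFun := act g⁻¹
      left_inv := fun p => by rw [← act_mul, inv_mul_cancel, act_one]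
      right_inv := fun p => by rw [← act_mul, mul_inv_cancel, act_one] }
  map_one' := Equiv.ext act_one
  map_mul' g g' := Equiv.ext (act_mul g g')

/-- Unfolding `actHom`. -/
theorem actHom_apply (g : Perm (Fin 4)) (p : Pairing) : actHom g p = act g p := rfl

/-- **`A₄` is transitive on the pairings**: every pairing is the image of `0` under an even
permutation (a three-cycle). -/
theorem exists_even_act_zero_eq : ∀ p : Pairing, ∃ σ : Perm (Fin 4), Perm.sign σ = 1 ∧ act σ 0 = p := by
  decide

/-- **The block sign is non-trivial on `A₄ ∩ D₈ = V₄`**: the double transposition `(0 2)(1 3)` is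
even, fixes the pairing `0 = {{0,1},{2,3}}` and exchanges its blocks. -/
theorem exists_even_stab_blockSign_neg :
    ∃ σ : Perm (Fin 4), Perm.sign σ = 1 ∧ act σ 0 = 0 ∧ blockSign σ 0 = -1 :=
  ⟨swap 0 2 * swap 1 3, by decide, by decide, by decide⟩

/-- The **signed indicator** `(1, 1, -1, -1)` of the pairing `0 = {{0,1},{2,3}}`. -/
def signVec (i : Fin 4) : ℤ := if (0 : Pairing).blk i then 1 else -1

/-- On the stabiliser of the pairing `0`, the signed indicator transforms by the block sign:
`e ∘ σ⁻¹ = blockSign σ • e`. -/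
theorem signVec_symm_apply : ∀ σ : Perm (Fin 4), act σ 0 = 0 →
    ∀ i : Fin 4, signVec (σ.symm i) = blockSign σ 0 * signVec i := by decide

/-- The three-cycle `c = (1 2 3)` fixing the root `0`: even, with `c 0 = 0`, `c 1 = 2`, `c 2 = 3`,
`c 3 = 1` (used to show `r₀ + r₁ ≠ r₂ + r₃` for `A₄ ≤ G`). -/
theorem cycle123_spec : Perm.sign (swap (1 : Fin 4) 2 * swap 2 3) = 1 ∧
    (swap (1 : Fin 4) 2 * swap 2 3 : Perm (Fin 4)) 0 = 0 ∧ (swap (1 : Fin 4) 2 * swap 2 3 : Perm (Fin 4)) 1 = 2 ∧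
    (swap (1 : Fin 4) 2 * swap 2 3 : Perm (Fin 4)) 2 = 3 ∧ (swap (1 : Fin 4) 2 * swap 2 3 : Perm (Fin 4)) 3 = 1 := by
  decide

/-- The values of the signed indicator. -/
theorem signVec_val : signVec 0 = 1 ∧ signVec 1 = 1 ∧ signVec 2 = -1 ∧ signVec 3 = -1 := by decide

end Pairing

end Summit.Langlands.Langlands.Theorems.ResidualAutomorphyEven
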